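import Literature.Computability.Complexity.GateEliminationRegate

/-!
# Gate elimination: the transfer lemma with deleted packed gates; Rule 4 with `ΔΦ ≤ 1`

Two sharpenings of the accounting toolkit for the one-step claim `LiYang2022_step` (Li–Yang,
STOC 2022; full version ECCC TR21-023, §3.3 and Lemma 3.11). Everything is PROVED.

* `exists_packing_transfer'` — the potential transfer lemma of `GateEliminationTransfer.lean`
  without the hypothesis that the packs of `𝒫` consist of kept gates: a pack containing a
  deleted gate is dropped, which is paid for by that deleted troubled gate, so still
  `Φ(C', 𝒫') ≤ Φ(C, 𝒫) + [A ≠ ∅] + [B ≠ ∅]`. Needed whenever a possibly troubled gate is deleted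
  outright (Rule 4 deletes the useless gate, which may be troubled).
* `rule4_core`, **`rule4_sharp`** — normalization Rule 4 (useless gates) with the printed
  accounting: "If `I₂` is a gate, it is the only gate that may become trouble; otherwise if it is
  a variable, newly introduced troubled gates must be fed by it, forming a troubled gate or a
  pack. Hence `Δμ ≥ 1 - α_φ`" (Lemma 3.11: `β ≥ 1 - α_φ` for Rules 2–5). The tree's `rule4`
  (`GateEliminationRegate.lean`) gives `Δμ ≥ 1 - 2α_φ`, enough for Case 0.1; the sharp form is
  the one needed when a second normalization step is counted (Case 6.1 of §4.1: "the elimination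
  of these two gates produce `ΔΦ ≤ 2` by normalization lemma"). The surgery is `regate` followed
  by `removeGate`; only the other input `I₂` of the reader `Q` loses wires (when `Q` lies in the
  cyclic xor-part, `Q` is re-gated as the other input of `G` xor a constant).
* `false_of_and_out_reads_var` — under the hypotheses of the one-step claim (dimension
  `≥ 2d + 1`) an ∧-type output gate reads no variable (the trivializing constant substitution
  would trivialize the output; cf. `exists_reader_of_and_protected` for protected variables).

## References

* J. Li, T. Yang, *3.1n − o(n) circuit lower bounds for explicit functions*, STOC 2022
  [LiYang2022]; full version ECCC TR21-023, §3.3 (Rule 4), Prop. 3.10, Lemma 3.11, §4.1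
  (Case 6.1), Prop. 2.4.
-/

namespace Literature.Computability.Complexity

open Finset

namespace Semicircuit

variable {n : ℕ}

/-- **Potential transfer lemma, second form** (the count behind Li–Yang's normalization rules,
§3.3, without the hypothesis that the packs of `𝒫` consist of kept gates): let the gates of `C'`
embed into those of `C` by `ι`, let adjacencies of kept troubled gates survive, and let every
new troubled gate of `C'` lie in `A ∪ B` for two good sets. Then `C'` has a packing `𝒫'` with
`Φ(C', 𝒫') ≤ Φ(C, 𝒫) + [A ≠ ∅] + [B ≠ ∅]`. A pack with a deleted gate is dropped, which is paid
for by that deleted troubled gate. [cite: LiYang2022, §3.3 (Rules 1–5), Prop. 3.10] -/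
theorem exists_packing_transfer' (C C' : Semicircuit n) (ι : Fin C'.m → Fin C.m)
    (hι : Function.Injective ι) {P : Finset (Fin C.m × Fin C.m)} (hP : C.IsPacking P)
    (hadj : ∀ k k', C'.Troubled k → C'.Troubled k' → C.Troubled (ι k) → C.Troubled (ι k') →
      C.Adjacent (ι k) (ι k') → C'.Adjacent k k')
    (A B : Finset (Fin C'.m))
    (hcover : ∀ k, C'.Troubled k → ¬ C.Troubled (ι k) → k ∈ A ∨ k ∈ B)
    (hA : C'.GoodCover A) (hB : C'.GoodCover B) :
    ∃ P' : Finset (Fin C'.m × Fin C'.m), C'.IsPacking P' ∧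
      C'.potential P' ≤ C.potential P + (if A = ∅ then 0 else 1 : ℕ) + (if B = ∅ then 0 else 1 : ℕ) := by
  classical
  set T' : Finset (Fin C'.m) := univ.filter fun k => C'.Troubled k with hT'
  set Told : Finset (Fin C'.m) := univ.filter fun k => C.Troubled (ι k) with hTold
  set N : Finset (Fin C'.m) := T' \ Told with hN
  set Pm : Finset (Fin C'.m × Fin C'.m) := univ.filter fun q => (ι q.1, ι q.2) ∈ P with hPm
  set Pold : Finset (Fin C'.m × Fin C'.m) := Pm.filter fun q => q.1 ∈ T' ∧ q.2 ∈ T' with hPold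
  -- the troubled gates of `C`, the kept ones, the deleted ones
  set TC : Finset (Fin C.m) := univ.filter fun g => C.Troubled g with hTC
  set Img : Finset (Fin C.m) := univ.image ι with hImg
  -- (1) `|P| ≤ |Pm| + |TC \ Img|`
  let emb : (Fin C'.m × Fin C'.m) ↪ (Fin C.m × Fin C.m) :=
    ⟨fun q => (ι q.1, ι q.2), fun q q' h => by
      simp only [Prod.mk.injEq] at h
      exact Prod.ext (hι h.1) (hι h.2)⟩
  have hPfilt : P.filter (fun p => p.1 ∈ Img ∧ p.2 ∈ Img) = Pm.map emb := by
    ext p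
    rw [mem_map, mem_filter]
    constructor
    · rintro ⟨hp, h1, h2⟩
      rw [hImg, mem_image] at h1 h2
      obtain ⟨k₁, -, hk₁⟩ := h1
      obtain ⟨k₂, -, hk₂⟩ := h2
      refine ⟨(k₁, k₂), ?_, ?_⟩
      · rw [hPm, mem_filter]
        refine ⟨mem_univ _, ?_⟩
        simp only [hk₁, hk₂, Prod.mk.eta, hp]
      · simp only [emb, Function.Embedding.coeFn_mk, hk₁, hk₂, Prod.mk.eta]
    · rintro ⟨q, hq, rfl⟩
      rw [hPm, mem_filter] at hq
      refine ⟨hq.2, ?_, ?_⟩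
      · exact mem_image_of_mem ι (mem_univ _)
      · exact mem_image_of_mem ι (mem_univ _)
  have hPT : ∀ p ∈ P, p.1 ∈ TC ∧ p.2 ∈ TC := by
    intro p hp
    obtain ⟨-, hT1, hT2, -⟩ := hP.1 p hp
    simp [hTC, hT1, hT2]
  have hP_le : P.card ≤ Pm.card + (TC \ Img).card := by
    have h := card_add_card_sdiff_ge_of_pairwise P TC Img hPT hP.2
    rw [hPfilt, card_map] at h
    exact h
  -- (2) dropped packs inject into un-troubled gates
  have hPmT : ∀ q ∈ Pm, q.1 ∈ Told ∧ q.2 ∈ Told := by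
    intro q hq
    rw [hPm, mem_filter] at hq
    obtain ⟨-, hT1, hT2, -⟩ := hP.1 _ hq.2
    simp [hTold, hT1, hT2]
  have hPm_dis : ∀ q ∈ Pm, ∀ q' ∈ Pm, q ≠ q' →
      q.1 ≠ q'.1 ∧ q.1 ≠ q'.2 ∧ q.2 ≠ q'.1 ∧ q.2 ≠ q'.2 := by
    intro q hq q' hq' hne
    rw [hPm, mem_filter] at hq hq'
    have hne' : emb q ≠ emb q' := fun h => hne (emb.injective h)
    have hd := hP.2 _ hq.2 _ hq'.2 hne'
    refine ⟨fun h => hd.1 (by rw [h]), fun h => hd.2.1 (by rw [h]), fun h => hd.2.2.1 (by rw [h]),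
      fun h => hd.2.2.2 (by rw [h])⟩
  have hdrop : Pm.card ≤ Pold.card + (Told \ T').card :=
    card_add_card_sdiff_ge_of_pairwise Pm Told T' hPmT hPm_dis
  -- (3) cover the new troubled gates by `A ∩ N` and `B ∩ N`
  have hNT' : N ⊆ T' := sdiff_subset
  have hT'mem : ∀ k, k ∈ T' ↔ C'.Troubled k := fun k => by simp [hT']
  set A' := A ∩ N with hA'
  set B' := B ∩ N with hB'
  have hNcov : N ⊆ A' ∪ B' := by
    intro k hk
    have hk' := hk
    rw [hN, mem_sdiff, hT'mem] at hk'
    have hkT : ¬ C.Troubled (ι k) := fun h => hk'.2 (by simp [hTold, h])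
    rw [mem_union, hA', hB', mem_inter, mem_inter]
    rcases hcover k hk'.1 hkT with h | h
    · exact Or.inl ⟨h, hk⟩
    · exact Or.inr ⟨h, hk⟩
  let Adj : Fin C'.m → Fin C'.m → Prop := fun u w => C'.Troubled u ∧ C'.Troubled w ∧ C'.Adjacent u w
  have hgood : ∀ {X : Finset (Fin C'.m)}, C'.GoodCover X →
      X.card ≤ 1 ∨ ∃ u w, u ≠ w ∧ X = {u, w} ∧ Adj u w := by
    intro X h
    rcases h with h | ⟨u, w, huw, rfl, hu, hw, hadj⟩
    · exact Or.inl h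
    · exact Or.inr ⟨u, w, huw, rfl, hu, hw, hadj⟩
  have hQN : ∀ p ∈ Pold, p.1 ∉ N ∧ p.2 ∉ N := by
    intro p hp
    have hp' := hPmT p (filter_subset _ _ hp)
    rw [hN]
    exact ⟨fun h => (mem_sdiff.mp h).2 hp'.1, fun h => (mem_sdiff.mp h).2 hp'.2⟩
  obtain ⟨Q', hsubQ, hcardN, hnew, hnewdis⟩ := exists_pairs_cover Adj Pold N A' B' hNcov
    (hgood (hA.subset inter_subset_left)) (hgood (hB.subset inter_subset_left))
    inter_subset_right inter_subset_right hQN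
  -- (4) `Q'` is a packing of `C'`
  have hPoldPm : Pold ⊆ Pm := filter_subset _ _
  refine ⟨Q', ⟨fun p hp => ?_, fun p hp p' hp' hne => ?_⟩, ?_⟩
  · by_cases hpo : p ∈ Pold
    · have hpm := hPoldPm hpo
      rw [hPold, mem_filter] at hpo
      rw [hPm, mem_filter] at hpm
      obtain ⟨hne, hT1, hT2, hadjC⟩ := hP.1 _ hpm.2
      refine ⟨fun h => hne (by rw [h]), (hT'mem _).mp hpo.2.1, (hT'mem _).mp hpo.2.2, ?_⟩
      exact hadj p.1 p.2 ((hT'mem _).mp hpo.2.1) ((hT'mem _).mp hpo.2.2) hT1 hT2 hadjC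
    · obtain ⟨hne, -, -, hT1, hT2, hadj'⟩ := hnew p (mem_sdiff.mpr ⟨hp, hpo⟩)
      exact ⟨hne, hT1, hT2, hadj'⟩
  · by_cases hpo : p ∈ Pold <;> by_cases hpo' : p' ∈ Pold
    · exact hPm_dis p (hPoldPm hpo) p' (hPoldPm hpo') hne
    · have ho := hPmT p (hPoldPm hpo)
      obtain ⟨-, hn1, hn2, -⟩ := hnew p' (mem_sdiff.mpr ⟨hp', hpo'⟩)
      rw [hN, mem_sdiff] at hn1 hn2
      exact ⟨fun h => hn1.2 (h ▸ ho.1), fun h => hn2.2 (h ▸ ho.1), fun h => hn1.2 (h ▸ ho.2),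
        fun h => hn2.2 (h ▸ ho.2)⟩
    · have ho := hPmT p' (hPoldPm hpo')
      obtain ⟨-, hn1, hn2, -⟩ := hnew p (mem_sdiff.mpr ⟨hp, hpo⟩)
      rw [hN, mem_sdiff] at hn1 hn2
      exact ⟨fun h => hn1.2 (h ▸ ho.1), fun h => hn1.2 (h ▸ ho.2), fun h => hn2.2 (h ▸ ho.1),
        fun h => hn2.2 (h ▸ ho.2)⟩
    · exact hnewdis p (mem_sdiff.mpr ⟨hp, hpo⟩) p' (mem_sdiff.mpr ⟨hp', hpo'⟩) hne
  · -- (5) the count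
    have hT'card : N.card + (T' ∩ Told).card = T'.card := card_sdiff_add_card_inter T' Told
    have hToldsplit : (Told \ T').card + (Told ∩ T').card = Told.card := card_sdiff_add_card_inter Told T'
    have hinter : T' ∩ Told = Told ∩ T' := inter_comm _ _
    -- kept troubled gates and deleted troubled gates are disjoint inside `TC`
    have hTold_le : Told.card + (TC \ Img).card ≤ C.troubledCount := by
      have h1 : Told.card = (TC ∩ Img).card := by
        have : TC ∩ Img = Told.image ι := by
          ext g
          constructor
          · intro hg'
            rw [mem_inter] at hg'
            obtain ⟨hg, hgi⟩ := hg'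
            rw [hImg, mem_image] at hgi
            obtain ⟨k, -, hk⟩ := hgi
            subst hk
            rw [hTC, mem_filter] at hg
            exact mem_image.mpr ⟨k, by simp [hTold, hg.2], rfl⟩
          · intro hg'
            obtain ⟨k, hk, hk'⟩ := mem_image.mp hg'
            subst hk'
            rw [hTold, mem_filter] at hk
            exact mem_inter.mpr ⟨by simp [hTC, hk.2], mem_image_of_mem ι (mem_univ _)⟩
        rw [this, card_image_of_injective _ hι]
      have h2 : (TC ∩ Img).card + (TC \ Img).card = TC.card := by
        rw [add_comm]; exact card_sdiff_add_card_inter TC Img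
      have h3 : C.troubledCount = TC.card := by unfold troubledCount; rw [hTC]
      omega
    have hPold_le : Pold.card ≤ Q'.card := card_le_card hsubQ
    have ht' : C'.troubledCount = T'.card := by
      unfold troubledCount; rw [hT']
    unfold potential
    rw [ht']
    rw [hinter] at hT'card
    have hiA : (if A' = ∅ then 0 else 1) ≤ (if A = ∅ then 0 else 1 : ℕ) := by
      by_cases h : A = ∅
      · rw [if_pos h, if_pos (by rw [hA', h, empty_inter])]
      · rw [if_neg h]; split_ifs <;> omega
    have hiB : (if B' = ∅ then 0 else 1) ≤ (if B = ∅ then 0 else 1 : ℕ) := by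
      by_cases h : B = ∅
      · rw [if_pos h, if_pos (by rw [hB', h, empty_inter])]
      · rw [if_neg h]; split_ifs <;> omega
    have hnat : T'.card + P.card ≤ C.troubledCount + Q'.card +
        (if A = ∅ then 0 else 1 : ℕ) + (if B = ∅ then 0 else 1 : ℕ) := by omega
    have hreal : (T'.card : ℝ) + P.card ≤ C.troubledCount + Q'.card +
        ((if A = ∅ then 0 else 1 : ℕ) : ℝ) + ((if B = ∅ then 0 else 1 : ℕ) : ℝ) := by exact_mod_cast hnat
    linarith

end Semicircuit

namespace Semicircuit

variable {n : ℕ} {C : Semicircuit n}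

section Rule4

variable {G Q : Fin C.m} {aQ : Fin 2}

/-- If `G` is a `1`-gate read by `Q` at position `aQ`, this is its only wire. [folklore] -/
theorem eq_of_reads_of_fanout_one (hG1 : C.fanout (.gate G) = 1) (hQG : C.arg Q aQ = .gate G)
    {k : Fin C.m} {a : Fin 2} (h : C.arg k a = .gate G) : k = Q ∧ a = aQ := by
  classical
  by_contra hcon
  have two : 2 ≤ C.fanout (.gate G) := by
    unfold fanout
    by_cases hk : k = Q
    · subst hk
      have ha : a ≠ aQ := fun ha => hcon ⟨rfl, ha⟩
      have hpair : ({a, aQ} : Finset (Fin 2)) ⊆ univ.filter fun a' : Fin 2 => C.arg k a' = .gate G := by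
        intro a' ha'
        rw [mem_insert, mem_singleton] at ha'
        rcases ha' with rfl | rfl
        · exact mem_filter.mpr ⟨mem_univ _, h⟩
        · exact mem_filter.mpr ⟨mem_univ _, hQG⟩
      have h2 : 2 ≤ (univ.filter fun a' : Fin 2 => C.arg k a' = .gate G).card := by
        have := card_le_card hpair
        rwa [card_pair ha] at this
      exact h2.trans (Finset.single_le_sum (f := fun j => (univ.filter fun a' : Fin 2 => C.arg j a' = .gate G).card)
        (fun _ _ => Nat.zero_le _) (mem_univ k))
    · have h1 : 1 ≤ (univ.filter fun a' : Fin 2 => C.arg k a' = .gate G).card :=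
        card_pos.mpr ⟨a, mem_filter.mpr ⟨mem_univ _, h⟩⟩
      have h1' : 1 ≤ (univ.filter fun a' : Fin 2 => C.arg Q a' = .gate G).card :=
        card_pos.mpr ⟨aQ, mem_filter.mpr ⟨mem_univ _, hQG⟩⟩
      have := Finset.add_le_sum (f := fun j => (univ.filter fun a' : Fin 2 => C.arg j a' = .gate G).card)
        (fun _ _ => Nat.zero_le _) (mem_univ k) (mem_univ Q) hk
      omega
  omega

/-- The wires of the reader `Q` (reading `G` at `aQ`) into a node other than `G` and its other
input: none. [folklore] -/
theorem card_wires_Q_eq_zero (hQG : C.arg Q aQ = .gate G) {u : Node n C.m} (huG : u ≠ .gate G)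
    (huI : u ≠ C.arg Q aQ.rev) : (univ.filter fun a : Fin 2 => C.arg Q a = u).card = 0 := by
  rw [card_eq_zero, filter_eq_empty_iff]
  intro a _ ha
  rcases fin2_eq_or_eq_rev aQ a with rfl | rfl
  · exact huG (ha.symm.trans hQG)
  · exact huI ha.symm

/-- The reader `Q` has exactly one wire into its other input (which is not `G`). [folklore] -/
theorem card_wires_Q_shared (hQG : C.arg Q aQ = .gate G) (hIG : C.arg Q aQ.rev ≠ .gate G) :
    (univ.filter fun a : Fin 2 => C.arg Q a = C.arg Q aQ.rev).card = 1 := by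
  rw [card_eq_one]
  refine ⟨aQ.rev, ?_⟩
  ext a
  simp only [mem_filter, mem_univ, true_and, mem_singleton]
  constructor
  · intro ha
    rcases fin2_eq_or_eq_rev aQ a with rfl | rfl
    · exact absurd (hQG.symm.trans ha) (Ne.symm hIG)
    · rfl
  · rintro rfl; rfl

/-- A node read by some gate has out-degree at least one. [folklore] -/
theorem one_le_fanout_of_arg_eq {k : Fin C.m} {a : Fin 2} {u : Node n C.m} (h : C.arg k a = u) :
    1 ≤ C.fanout u := by
  by_contra h0
  exact (C.fanout_eq_zero_iff u).mp (by omega) k a h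

variable (C) (Q) (op' : Bool → Bool → Bool) (args' : Fin 2 → Node n C.m) (hOK : C.RegateOK Q op' args')

include hOK in
/-- **Rule 4, the common core.** Let `G` be a `1`-gate read by `Q ≠ G` at position `aQ`, not the
output, and let `Q` be re-gated (`regate`) by an equivalent equation with wires `args'` not
reading `G`, such that the wires of `args'` into any non-constant node are at most those of `G`
into it, with equality except at the other input `I₂ = arg Q aQ.rev` of `Q`, and such that `Q`
reads `I₂` or a constant afterwards (the surgery is `regate` of `GateEliminationRegate.lean`). Then deleting `G` gives a fair semicircuit computing `f|_R`
with one gate fewer and `Δμ ≥ 1 - α_φ`: only `I₂` loses wires, so the new troubled gates are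
caused by `I₂` ("If `I₂` is a gate, it is the only gate that may become trouble; otherwise if it
is a variable, newly introduced troubled gates must be fed by it, forming a troubled gate or a
pack. Hence `Δμ ≥ 1 - α_φ`"). [cite: LiYang2022, §3.3 (Rule 4), Lemma 3.11] -/
theorem rule4_core (hG1 : C.fanout (.gate G) = 1) (hQG : C.arg Q aQ = .gate G) (hne : Q ≠ G)
    {f : (Fin n → ZMod 2) → Bool} {R : RdqSource n} (hF : C.Fair)
    (hC : C.ComputesRestr f R) {P : Finset (Fin C.m × Fin C.m)} (hP : C.IsPacking P)
    (hout : C.out ≠ .gate G)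
    (heq : ∀ (x : Fin n → Bool) (w : Fin C.m → Bool), (∀ j, j ≠ Q → C.GateEq x w j) →
      (w Q = op' (C.nodeVal x w (args' 0)) (C.nodeVal x w (args' 1)) ↔ C.GateEq x w Q))
    (hW1 : ∀ a, args' a ≠ .gate G)
    (hle : ∀ u : Node n C.m, (∀ b, u ≠ .const b) →
      (univ.filter fun a : Fin 2 => args' a = u).card ≤ (univ.filter fun a : Fin 2 => C.arg G a = u).card)
    (hle' : ∀ u : Node n C.m, (∀ b, u ≠ .const b) → u ≠ C.arg Q aQ.rev →
      (univ.filter fun a : Fin 2 => args' a = u).card = (univ.filter fun a : Fin 2 => C.arg G a = u).card)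
    (hvar : ∀ a i, args' a = .var i → 1 ≤ C.fanout (.var i))
    (hW6 : (∃ a, args' a = C.arg Q aQ.rev) ∨ ∃ a b, args' a = .const b)
    {αφ αI : ℝ} (hφ : 0 ≤ αφ) (hI : 0 ≤ αI) (αQ : ℝ) :
    ∃ (C' : Semicircuit n) (P' : Finset (Fin C'.m × Fin C'.m)), C'.Fair ∧ C'.ComputesRestr f R ∧
      C'.IsPacking P' ∧ C'.m + 1 = C.m ∧
      C'.measure αφ αI αQ P' R ≤ C.measure αφ αI αQ P R - (1 - αφ) := by
  classical
  -- nobody reads `G` after re-gating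
  have h0₁ : ∀ k a, (C.regate Q op' args' hOK).arg k a ≠ .gate G := by
    intro k a
    rw [regate_arg]
    split_ifs with hk
    · exact hW1 a
    · intro h
      exact hk (eq_of_reads_of_fanout_one hG1 hQG h).1
  have hF₁ : (C.regate Q op' args' hOK).Fair := hF.regate heq
  have hC₁' : (C.regate Q op' args' hOK).ComputesRestr f R := hC.regate (C.consistent_regate_iff Q op' args' hOK heq) hvar
  let ε := (C.regate Q op' args' hOK).skipEquiv G
  have hF₂ : ((C.regate Q op' args' hOK).removeGate G ε).Fair := hF₁.removeGate ε h0₁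
  have hout₁ : (C.regate Q op' args' hOK).out ≠ .gate G := hout
  have hC₂' : ((C.regate Q op' args' hOK).removeGate G ε).ComputesRestr f R := hC₁'.removeGate ε hF₁ h0₁ hout₁
  have hm : ((C.regate Q op' args' hOK).removeGate G ε).m + 1 = C.m := (C.regate Q op' args' hOK).removeGate_m_add_one G ε
  let ι : Fin ((C.regate Q op' args' hOK).removeGate G ε).m → Fin C.m := fun k => (ε k : Fin C.m)
  have hιinj : Function.Injective ι := fun k k' h => ε.injective (Subtype.ext h)
  -- the out-degree bookkeeping
  have hfan : ∀ u : Node n C.m, u ≠ .gate G →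
      ((C.regate Q op' args' hOK).removeGate G ε).fanout (u.skip G ε) + (univ.filter fun a : Fin 2 => C.arg G a = u).card +
        (univ.filter fun a : Fin 2 => C.arg Q a = u).card =
      C.fanout u + (univ.filter fun a : Fin 2 => args' a = u).card := by
    intro u hu
    have h1 := (C.regate Q op' args' hOK).fanout_removeGate_add G ε h0₁ hu
    have h2 := C.fanout_regate_add Q op' args' hOK u
    have h3 : (univ.filter fun a : Fin 2 => (C.regate Q op' args' hOK).arg G a = u) = (univ.filter fun a : Fin 2 => C.arg G a = u) := by
      ext a; simp only [mem_filter, mem_univ, true_and, if_neg hne.symm]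
    rw [h3] at h1
    omega
  have hfan_eq : ∀ u : Node n C.m, u ≠ .gate G → (∀ b, u ≠ .const b) → u ≠ C.arg Q aQ.rev →
      ((C.regate Q op' args' hOK).removeGate G ε).fanout (u.skip G ε) = C.fanout u := by
    intro u hu hub huI
    have h := hfan u hu
    rw [card_wires_Q_eq_zero hQG hu huI, hle' u hub huI] at h
    omega
  have hfan_le : ∀ u : Node n C.m, u ≠ .gate G → (∀ b, u ≠ .const b) →
      ((C.regate Q op' args' hOK).removeGate G ε).fanout (u.skip G ε) ≤ C.fanout u := by
    intro u hu hub
    have h := hfan u hu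
    have := hle u hub
    omega
  -- wires of kept gates
  have harg₂ : ∀ (k : Fin ((C.regate Q op' args' hOK).removeGate G ε).m) (a : Fin 2), ι k ≠ Q →
      ((C.regate Q op' args' hOK).removeGate G ε).arg k a = (C.arg (ι k) a).skip G ε := by
    intro k a hk
    show ((C.regate Q op' args' hOK).arg (ε k) a).skip G ε = _
    rw [regate_arg, if_neg hk]
  have harg₂Q : ∀ (k : Fin ((C.regate Q op' args' hOK).removeGate G ε).m) (a : Fin 2), ι k = Q →
      ((C.regate Q op' args' hOK).removeGate G ε).arg k a = (args' a).skip G ε := by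
    intro k a hk
    show ((C.regate Q op' args' hOK).arg (ε k) a).skip G ε = _
    rw [regate_arg, if_pos hk]
  have hQT : ¬ C.Troubled Q := not_troubled_of_reads_gate hQG
  -- new troubled gates are caused by `I₂`
  have hcause : ∀ k, ((C.regate Q op' args' hOK).removeGate G ε).Troubled k → ¬ C.Troubled (ι k) →
      CausedBy C ((C.regate Q op' args' hOK).removeGate G ε) ι (C.arg Q aQ.rev) k := by
    intro k hT' hT
    by_cases hkQ : ι k = Q
    · -- `Q` itself: it reads `I₂` (a variable, if troubled) or a constant (not troubled)
      obtain ⟨-, -, x, y, -, hr, -, -⟩ := hT'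
      rcases hW6 with ⟨a, ha⟩ | ⟨a, b, hab⟩
      · have hmem : (args' a).skip G ε ∈ Set.range (((C.regate Q op' args' hOK).removeGate G ε).arg k) := ⟨a, harg₂Q k a hkQ⟩
        rw [hr, ha] at hmem
        rcases hmem with h | h
        · refine Or.inr ⟨x, (Node.skip_eq_var_iff G ε).mp h, a, ?_⟩
          rw [harg₂Q k a hkQ, ha]; exact h
        · rw [Set.mem_singleton_iff] at h
          refine Or.inr ⟨y, (Node.skip_eq_var_iff G ε).mp h, a, ?_⟩
          rw [harg₂Q k a hkQ, ha]; exact h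
      · have hmem : (args' a).skip G ε ∈ Set.range (((C.regate Q op' args' hOK).removeGate G ε).arg k) := ⟨a, harg₂Q k a hkQ⟩
        rw [hr, hab, Node.skip_const] at hmem
        rcases hmem with h | h
        · cases h
        · cases h
    · by_contra hcon
      unfold CausedBy at hcon
      push Not at hcon
      obtain ⟨hand, h1, x, y, hxy, hr, hx, hy⟩ := hT'
      have hkG : ι k ≠ G := (ε k).2
      have hr' : Set.range (C.arg (ι k)) = {Node.var x, Node.var y} := by
        have := ((C.regate Q op' args' hOK).range_arg_removeGate_eq_pair_iff G ε k x y).mp hr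
        have hC₁arg : (C.regate Q op' args' hOK).arg (ε k) = C.arg (ι k) := funext fun a => by rw [regate_arg, if_neg hkQ]
        rwa [hC₁arg] at this
      have hreads₂ : ∀ z : Fin n, (∃ a, C.arg (ι k) a = .var z) → ∃ a, ((C.regate Q op' args' hOK).removeGate G ε).arg k a = .var z := by
        rintro z ⟨a, ha⟩
        exact ⟨a, by rw [harg₂ k a hkQ, ha, Node.skip_var]⟩
      have hxr : ∃ a, C.arg (ι k) a = .var x := by
        have : (Node.var x : Node n C.m) ∈ Set.range (C.arg (ι k)) := by rw [hr']; simp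
        exact this
      have hyr : ∃ a, C.arg (ι k) a = .var y := by
        have : (Node.var y : Node n C.m) ∈ Set.range (C.arg (ι k)) := by rw [hr']; simp
        exact this
      apply hT
      have hop : ((C.regate Q op' args' hOK).removeGate G ε).op k = C.op (ι k) := by
        show (C.regate Q op' args' hOK).op (ε k) = C.op (ι k)
        rw [regate_op_of_ne _ _ _ _ _ hkQ]
      refine ⟨hop ▸ hand, ?_, x, y, hxy, hr', ?_, ?_⟩
      · rw [← hfan_eq (.gate (ι k)) (fun h => hkG (Node.gate.inj h)) (fun b h => by cases h) (fun h => hcon.1 h.symm)]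
        rw [Node.skip_gate_coe]; exact h1
      · rw [← hfan_eq (.var x) (by simp) (fun b h => by cases h) (fun h => hcon.2 x h.symm _ (hreads₂ x hxr).choose_spec)]
        exact hx
      · rw [← hfan_eq (.var y) (by simp) (fun b h => by cases h) (fun h => hcon.2 y h.symm _ (hreads₂ y hyr).choose_spec)]
        exact hy
  have hadj : ∀ k k', ((C.regate Q op' args' hOK).removeGate G ε).Troubled k → ((C.regate Q op' args' hOK).removeGate G ε).Troubled k' →
      C.Troubled (ι k) → C.Troubled (ι k') → C.Adjacent (ι k) (ι k') → ((C.regate Q op' args' hOK).removeGate G ε).Adjacent k k' := by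
    intro k k' _ _ hTk hTk' hadjC
    obtain ⟨z, hz, hz'⟩ := hadjC
    have hkQ : ι k ≠ Q := fun h => hQT (h ▸ hTk)
    have hkQ' : ι k' ≠ Q := fun h => hQT (h ▸ hTk')
    refine ⟨z, ?_, ?_⟩
    · obtain ⟨a, ha⟩ := hz; exact ⟨a, by rw [harg₂ k a hkQ, ha, Node.skip_var]⟩
    · obtain ⟨a, ha⟩ := hz'; exact ⟨a, by rw [harg₂ k' a hkQ', ha, Node.skip_var]⟩
  set A : Finset (Fin ((C.regate Q op' args' hOK).removeGate G ε).m) :=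
    univ.filter fun k => ((C.regate Q op' args' hOK).removeGate G ε).Troubled k ∧ CausedBy C ((C.regate Q op' args' hOK).removeGate G ε) ι (C.arg Q aQ.rev) k
    with hA
  have hAgood : ((C.regate Q op' args' hOK).removeGate G ε).GoodCover A :=
    goodCover_causedBy C _ ι hιinj (C.arg Q aQ.rev) A fun k hk => (mem_filter.mp hk).2
  have hcover : ∀ k, ((C.regate Q op' args' hOK).removeGate G ε).Troubled k → ¬ C.Troubled (ι k) →
      k ∈ A ∨ k ∈ (∅ : Finset (Fin ((C.regate Q op' args' hOK).removeGate G ε).m)) :=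
    fun k hk hkT => Or.inl (mem_filter.mpr ⟨mem_univ _, hk, hcause k hk hkT⟩)
  obtain ⟨P₂, hP₂, hpot⟩ := exists_packing_transfer' C _ ι hιinj hP hadj A ∅ hcover hAgood (Or.inl (by simp))
  have hpot' : ((C.regate Q op' args' hOK).removeGate G ε).potential P₂ ≤ C.potential P + 1 := by
    refine hpot.trans ?_
    have h1 : ((if A = ∅ then 0 else 1 : ℕ) : ℝ) ≤ 1 := by exact_mod_cast ite_empty_le_one A
    have h2 : ((if (∅ : Finset (Fin ((C.regate Q op' args' hOK).removeGate G ε).m)) = ∅ then 0 else 1 : ℕ) : ℝ) = 0 := by simp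
    linarith
  -- influential inputs do not appear
  have hinf : ((C.regate Q op' args' hOK).removeGate G ε).influential R ⊆ C.influential R := by
    intro i hi
    unfold influential at hi ⊢
    rw [mem_filter] at hi ⊢
    refine ⟨mem_univ _, hi.2.imp_left fun h => ?_⟩
    have := hfan_le (.var i) (by simp) (fun b h => by cases h)
    rw [Node.skip_var] at this
    omega
  refine ⟨(C.regate Q op' args' hOK).removeGate G ε, P₂, hF₂, hC₂', hP₂, hm, ?_⟩
  have hinf' : ((((C.regate Q op' args' hOK).removeGate G ε).influential R).card : ℝ) ≤ (C.influential R).card := by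
    exact_mod_cast card_le_card hinf
  have hm' : ((((C.regate Q op' args' hOK).removeGate G ε).m : ℕ) : ℝ) + 1 = C.m := by exact_mod_cast hm
  unfold measure
  nlinarith [mul_le_mul_of_nonneg_left hinf' hI, mul_le_mul_of_nonneg_left hpot' hφ]

omit op' args' hOK in
/-- **Normalization Rule 4, with the printed accounting `ΔΦ ≤ 1`** (Li–Yang §3.3): "A gate `G` is called useless if it is a `1`-gate
with only descendant `Q`, such that the other input of `Q` also feeds `G`. We may eliminate `G`
and rewire the nodes feeding it to feed `Q` … `ΔΦ ≤ 1` … Hence `Δμ ≥ 1 - α_φ`." Here for a gate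
`G` with two distinct wires that is not the output, read (once, as its only wire) by `Q ≠ G`
whose other wire is a wire of `G`: `Q` is redefined on the two inputs of `G` with the composite
function (if `Q` is in the cyclic xor-part, where both gates are ⊕-type and the shared input
cancels, `Q` is redefined as the other input of `G` xor a constant), and `G` is deleted.
[cite: LiYang2022, §3.3 (Rule 4), Lemma 3.11] -/
theorem rule4_sharp (hG1 : C.fanout (.gate G) = 1) (hQG : C.arg Q aQ = .gate G) (hne : Q ≠ G)
    {p : Fin 2} (hshare : C.arg Q aQ.rev = C.arg G p) (hdist : C.arg G 0 ≠ C.arg G 1)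
    {f : (Fin n → ZMod 2) → Bool} {R : RdqSource n} (hF : C.Fair)
    (hC : C.ComputesRestr f R) {P : Finset (Fin C.m × Fin C.m)} (hP : C.IsPacking P)
    (hout : C.out ≠ .gate G) {αφ αI : ℝ} (hφ : 0 ≤ αφ) (hI : 0 ≤ αI) (αQ : ℝ) :
    ∃ (C' : Semicircuit n) (P' : Finset (Fin C'.m × Fin C'.m)), C'.Fair ∧ C'.ComputesRestr f R ∧
      C'.IsPacking P' ∧ C'.m + 1 = C.m ∧
      C'.measure αφ αI αQ P' R ≤ C.measure αφ αI αQ P R - (1 - αφ) := by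
  classical
  have hGself : ∀ a, C.arg G a ≠ .gate G := fun a h => hne (eq_of_reads_of_fanout_one hG1 hQG h).1.symm
  have hI12 : C.arg G p.rev ≠ C.arg G p := by
    obtain rfl | rfl : p = 0 ∨ p = 1 := by fin_cases p <;> simp
    · exact fun h => hdist h.symm
    · exact fun h => hdist h
  -- positions of `G` wired to a node
  have hposG : ∀ (u : Node n C.m) (a : Fin 2), C.arg G a = u → u = C.arg G p ∨ u = C.arg G p.rev := by
    intro u a ha
    rcases fin2_eq_or_eq_rev p a with rfl | rfl
    · exact Or.inl ha.symm
    · exact Or.inr ha.symm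
  by_cases hQx : Q ∈ C.xorPart
  · -- the cyclic case: `Q := I₁ ⊕ const`
    have hGx : G ∈ C.xorPart := C.mem_of_arg_eq Q hQx aQ G hQG
    obtain ⟨cQ, hcQ⟩ := C.isXorOp_of_mem Q hQx
    obtain ⟨cG, hcG⟩ := C.isXorOp_of_mem G hGx
    let args' : Fin 2 → Node n C.m := fun a => if a = 0 then C.arg G p.rev else .const false
    let op' : Bool → Bool → Bool := fun b₀ b₁ => (b₀ ^^ b₁) ^^ (cG ^^ cQ)
    have hargs0 : args' 0 = C.arg G p.rev := rfl
    have hargs1 : args' 1 = .const false := rfl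
    have hxor : Q ∈ C.xorPart → IsXorOp op' ∧ ∀ a k, args' a = .gate k → k ∈ C.xorPart := by
      refine fun _ => ⟨⟨cG ^^ cQ, fun a b => rfl⟩, fun a k hk => ?_⟩
      obtain rfl | rfl : a = 0 ∨ a = 1 := by fin_cases a <;> simp
      · rw [hargs0] at hk; exact C.mem_of_arg_eq G hGx _ k hk
      · rw [hargs1] at hk; cases hk
    have hacyc : Q ∉ C.xorPart → ∀ a k, args' a = .gate k → k ∉ C.xorPart → ∀ ρ, C.IsRank ρ → ρ k < ρ Q :=
      fun h => absurd hQx h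
    refine rule4_core C Q op' args' ⟨hxor, hacyc⟩ hG1 hQG hne hF hC hP hout ?_ ?_ ?_ ?_ ?_ ?_ hφ hI αQ
    · -- the equation
      intro x w hrest
      have hG := hrest G hne.symm
      unfold GateEq at hG ⊢
      rw [hcQ]
      rw [hcG] at hG
      rw [hargs0, hargs1]
      -- the values at the positions of `Q` and `G`
      have key : ∀ (vQ0 vQ1 vG0 vG1 vI1 : Bool), (C.nodeVal x w (C.arg Q 0) = vQ0) → (C.nodeVal x w (C.arg Q 1) = vQ1) →
          (C.nodeVal x w (C.arg G 0) = vG0) → (C.nodeVal x w (C.arg G 1) = vG1) →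
          (C.nodeVal x w (C.arg G p.rev) = vI1) →
          ((vI1 ^^ false) ^^ (cG ^^ cQ)) = ((vQ0 ^^ vQ1) ^^ cQ) := by
        intro vQ0 vQ1 vG0 vG1 vI1 h0 h1 g0 g1 hi1
        have hwG : w G = ((vG0 ^^ vG1) ^^ cG) := by rw [hG, g0, g1]
        obtain rfl | rfl : aQ = 0 ∨ aQ = 1 := by fin_cases aQ <;> simp
        · have e0 : vQ0 = w G := by rw [← h0, hQG]; rfl
          have e1 : vQ1 = C.nodeVal x w (C.arg G p) := by rw [← h1, ← hshare]; rfl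
          obtain rfl | rfl : p = 0 ∨ p = 1 := by fin_cases p <;> simp
          · have : vI1 = vG1 := by rw [← hi1, ← g1]; rfl
            rw [e0, e1, hwG, g0, this]
            cases vG0 <;> cases vG1 <;> cases cG <;> cases cQ <;> rfl
          · have : vI1 = vG0 := by rw [← hi1, ← g0]; rfl
            rw [e0, e1, hwG, g1, this]
            cases vG0 <;> cases vG1 <;> cases cG <;> cases cQ <;> rfl
        · have e1 : vQ1 = w G := by rw [← h1, hQG]; rfl
          have e0 : vQ0 = C.nodeVal x w (C.arg G p) := by rw [← h0, ← hshare]; rfl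
          obtain rfl | rfl : p = 0 ∨ p = 1 := by fin_cases p <;> simp
          · have : vI1 = vG1 := by rw [← hi1, ← g1]; rfl
            rw [e0, e1, hwG, g0, this]
            cases vG0 <;> cases vG1 <;> cases cG <;> cases cQ <;> rfl
          · have : vI1 = vG0 := by rw [← hi1, ← g0]; rfl
            rw [e0, e1, hwG, g1, this]
            cases vG0 <;> cases vG1 <;> cases cG <;> cases cQ <;> rfl
      show w Q = ((C.nodeVal x w (C.arg G p.rev) ^^ false) ^^ (cG ^^ cQ)) ↔ _
      rw [key _ _ _ _ _ rfl rfl rfl rfl rfl]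
    · intro a
      obtain rfl | rfl : a = 0 ∨ a = 1 := by fin_cases a <;> simp
      · rw [hargs0]; exact hGself _
      · rw [hargs1]; exact fun h => by cases h
    · intro u hub
      by_cases hu : u = C.arg G p.rev
      · have h1 : (univ.filter fun a : Fin 2 => args' a = u).card ≤ 1 := by
          have : (univ.filter fun a : Fin 2 => args' a = u) ⊆ {0} := by
            intro a ha
            rw [mem_filter] at ha
            obtain rfl | rfl : a = 0 ∨ a = 1 := by fin_cases a <;> simp
            · exact mem_singleton_self _
            · rw [hargs1] at ha; exact absurd ha.2.symm (hub false)
          exact (card_le_card this).trans (by simp)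
        have h2 : 1 ≤ (univ.filter fun a : Fin 2 => C.arg G a = u).card :=
          card_pos.mpr ⟨p.rev, mem_filter.mpr ⟨mem_univ _, hu.symm⟩⟩
        omega
      · have : (univ.filter fun a : Fin 2 => args' a = u) = ∅ := by
          rw [filter_eq_empty_iff]
          intro a _ ha
          obtain rfl | rfl : a = 0 ∨ a = 1 := by fin_cases a <;> simp
          · exact hu (ha ▸ hargs0.symm)
          · rw [hargs1] at ha; exact hub false ha.symm
        rw [this, card_empty]; exact Nat.zero_le _
    · intro u hub huI
      rw [hshare] at huI
      by_cases hu : u = C.arg G p.rev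
      · subst hu
        have h1 : (univ.filter fun a : Fin 2 => args' a = C.arg G p.rev) = {0} := by
          ext a
          simp only [mem_filter, mem_univ, true_and, mem_singleton]
          obtain rfl | rfl : a = 0 ∨ a = 1 := by fin_cases a <;> simp
          · simp [hargs0]
          · rw [hargs1]; simp only [one_ne_zero, iff_false]; exact fun h => hub false h.symm
        have h2 : (univ.filter fun a : Fin 2 => C.arg G a = C.arg G p.rev) = {p.rev} := by
          ext a
          simp only [mem_filter, mem_univ, true_and, mem_singleton]
          constructor
          · intro ha
            rcases fin2_eq_or_eq_rev p a with rfl | rfl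
            · exact absurd ha.symm huI
            · rfl
          · rintro rfl; rfl
        rw [h1, h2, card_singleton, card_singleton]
      · have h1 : (univ.filter fun a : Fin 2 => args' a = u) = ∅ := by
          rw [filter_eq_empty_iff]
          intro a _ ha
          obtain rfl | rfl : a = 0 ∨ a = 1 := by fin_cases a <;> simp
          · exact hu (ha ▸ hargs0.symm)
          · rw [hargs1] at ha; exact hub false ha.symm
        have h2 : (univ.filter fun a : Fin 2 => C.arg G a = u) = ∅ := by
          rw [filter_eq_empty_iff]
          intro a _ ha
          rcases hposG u a ha with h | h
          · exact huI h
          · exact hu h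
        rw [h1, h2]
    · intro a i hi
      obtain rfl | rfl : a = 0 ∨ a = 1 := by fin_cases a <;> simp
      · rw [hargs0] at hi; exact one_le_fanout_of_arg_eq hi
      · rw [hargs1] at hi; cases hi
    · exact Or.inr ⟨1, false, hargs1⟩
  · -- the acyclic case: `Q` redefined on the inputs of `G` with the composite function
    let args' : Fin 2 → Node n C.m := C.arg G
    let sel : Bool → Bool → Bool := fun b₀ b₁ => if p = 0 then b₀ else b₁
    let op' : Bool → Bool → Bool := fun b₀ b₁ =>
      if aQ = 0 then C.op Q (C.op G b₀ b₁) (sel b₀ b₁) else C.op Q (sel b₀ b₁) (C.op G b₀ b₁)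
    have hxor : Q ∈ C.xorPart → IsXorOp op' ∧ ∀ a k, args' a = .gate k → k ∈ C.xorPart :=
      fun h => absurd h hQx
    have hacyc : Q ∉ C.xorPart → ∀ a k, args' a = .gate k → k ∉ C.xorPart → ∀ ρ, C.IsRank ρ → ρ k < ρ Q := by
      intro _ a k hk hkx ρ hρ
      have hGx : G ∉ C.xorPart := fun hGx => hkx (C.mem_of_arg_eq G hGx a k hk)
      exact (hρ G hGx a k hk hkx).trans (hρ Q hQx aQ G hQG hGx)
    refine rule4_core C Q op' args' ⟨hxor, hacyc⟩ hG1 hQG hne hF hC hP hout ?_ ?_ ?_ ?_ ?_ ?_ hφ hI αQ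
    · intro x w hrest
      have hG := hrest G hne.symm
      unfold GateEq at hG ⊢
      have key : ∀ (vQ0 vQ1 vG0 vG1 : Bool), (C.nodeVal x w (C.arg Q 0) = vQ0) → (C.nodeVal x w (C.arg Q 1) = vQ1) →
          (C.nodeVal x w (C.arg G 0) = vG0) → (C.nodeVal x w (C.arg G 1) = vG1) →
          op' vG0 vG1 = C.op Q vQ0 vQ1 := by
        intro vQ0 vQ1 vG0 vG1 h0 h1 g0 g1
        have hwG : w G = C.op G vG0 vG1 := by rw [hG, g0, g1]
        have hsel : sel vG0 vG1 = C.nodeVal x w (C.arg G p) := by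
          obtain rfl | rfl : p = 0 ∨ p = 1 := by fin_cases p <;> simp
          · exact g0.symm
          · exact g1.symm
        obtain rfl | rfl : aQ = 0 ∨ aQ = 1 := by fin_cases aQ <;> simp
        · have e0 : vQ0 = w G := by rw [← h0, hQG]; rfl
          have e1 : vQ1 = C.nodeVal x w (C.arg G p) := by rw [← h1, ← hshare]; rfl
          show C.op Q (C.op G vG0 vG1) (sel vG0 vG1) = C.op Q vQ0 vQ1
          rw [e0, e1, hwG, hsel]
        · have e1 : vQ1 = w G := by rw [← h1, hQG]; rfl
          have e0 : vQ0 = C.nodeVal x w (C.arg G p) := by rw [← h0, ← hshare]; rfl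
          show C.op Q (sel vG0 vG1) (C.op G vG0 vG1) = C.op Q vQ0 vQ1
          rw [e0, e1, hwG, hsel]
      show w Q = op' (C.nodeVal x w (C.arg G 0)) (C.nodeVal x w (C.arg G 1)) ↔ _
      rw [key _ _ _ _ rfl rfl rfl rfl]
    · exact hGself
    · exact fun u _ => le_rfl
    · exact fun u _ _ => rfl
    · exact fun a i hi => one_le_fanout_of_arg_eq hi
    · exact Or.inl ⟨p, hshare.symm⟩

end Rule4

/-! ### An ∧-type output gate reads no variable -/

/-- **Under the hypotheses of the one-step claim, an ∧-type output gate reads no variable**: the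
constant substitution trivializing it would make the output trivialized, while the function is
not constant on a source of dimension `≥ 2d` (Li–Yang: "the function is not trivial after
performing these substitutions, so the output gate of the circuit will not be trivialized").
[cite: LiYang2022, proof of Thm. 4.1 (§4.1), Prop. 2.4] -/
theorem false_of_and_out_reads_var {C : Semicircuit n} {f : (Fin n → ZMod 2) → Bool} {R : RdqSource n} {d : ℕ}
    (hf : IsAffineDisperser f d) (hd : 2 * d + 1 ≤ R.dim) (hF : C.Fair) (hC : C.ComputesRestr f R)
    {G : Fin C.m} (hout : C.out = .gate G) (hand : IsAndOp (C.op G)) {a : Fin 2} {j : Fin n}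
    (hGj : C.arg G a = .var j) : False := by
  have hj : R.Free j := free_of_reads hC hGj
  obtain ⟨b, hb⟩ := exists_trivializing hand a
  let c : ZMod 2 := finTwoEquiv.symm b
  have hcb : finTwoEquiv c = b := finTwoEquiv.apply_symm_apply b
  have h₀ : (C.substConst j (finTwoEquiv c)).arg G a = .const b := by
    rw [substConst_arg, hGj, Node.substConst_var_self, hcb]
  have htriv : (C.substConst j (finTwoEquiv c)).liveFn G a b false =
      (C.substConst j (finTwoEquiv c)).liveFn G a b true := hb
  have hout₁ : (C.substConst j (finTwoEquiv c)).out = .gate G := by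
    rw [substConst_out, hout]; rfl
  by_cases hjp : R.Protected j
  · obtain ⟨-, l, e, he, hr⟩ := hjp
    have hC₁ := hC.substConst_assignProtected he hr c
    have hd₁ : 2 * d ≤ (RdqSource.assignProtected he hr c).dim := by
      have := RdqSource.dim_assignProtected he hr c; omega
    exact out_ne_of_trivialized hf hd₁ (hF.substConst j _) hC₁ h₀ htriv hout₁
  · have hC₁ := hC.substConst_assignFree hj hjp c
    have hd₁ : 2 * d ≤ (R.assignFree j c hj hjp).dim := by
      have := R.dim_assignFree (j := j) (b := c) (hj := hj) (hjp := hjp); omega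
    exact out_ne_of_trivialized hf hd₁ (hF.substConst j _) hC₁ h₀ htriv hout₁

end Semicircuit

end Literature.Computability.Complexity
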